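import Literature.AlgebraicGeometry.HodgeTheory.PeriodIntegralHolomorphic
import HarnessLib

/-!
# Holomorphy of period-type integrals, vertical form: `∂̄ ∫_M φ^*β ∧ Ψ_p^* Ξ = 0` when `dΞ` is
# `ℂ`-linear in the transverse direction along the fibre

Topic: Hodge theory in families (Griffiths 1968 / Voisin I §10.2.2). Theorems only, no new facts.
Companion of `PeriodIntegralHolomorphic` (same setting, same proof skeleton), written by the prover seat
`hodge-nonav-prover-Ax` (g11, cell `hodge-nonav`) for the programme «GRIFFITHS-SURFACES» (holomorphic
variation of the Griffiths residue classes of a family of smooth hypersurfaces).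

`PeriodIntegralHolomorphic.differentiableAt_complex_cintegral_wedge_pullback_family` proves the complex
differentiability of `G(p) = ∫_M φ^*β ∧ Ψ_p^*Ξ` at `t` for a `(k+1)`-form `Ξ` on the total space with
`ι^*Ξ = 0` and `dΞ ∈ F^{p₀}` along the fibre, against a closed `β ∈ F^{n−p₀+1}` — the TYPE mechanism of
Voisin's proof of Thm. 10.9. This file proves the variant adapted to RELATIVE HOLOMORPHIC forms: the
hypotheses on `Ξ` become

* `ι^*Ξ` is CLOSED on the fibre (e.g. `Ξ` restricts to a holomorphic top-degree form of the fibre), and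
* along the fibre, `dΞ` is `ℂ`-LINEAR in its first (transverse) slot once the other slots are filled
  with vertical vectors: `dΞ(i v, dι w₁, …, dι w_{k+1}) = i · dΞ(v, dι w₁, …, dι w_{k+1})` (e.g. `Ξ`
  holomorphic, `dΞ = ∂Ξ` of type `(k+2, 0)`; or `Ξ` a partition-of-unity gluing of local holomorphic
  forms with equal fibre restrictions, whose `dΞ` differs from type `(k+2,0)` by terms in the ideal of
  the pulled-back `(1,0)`-forms of the base),

and `β` is ANY closed form of complementary degree (no type condition).  Conclusion
(`differentiableAt_complex_cintegral_wedge_pullback_family_of_vertical`): `G` is complex differentiable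
at `t`.  Proof: by the variation formula (`hasFDerivAt_cintegral_wedge_pullback_family`) the real
derivative is `∂_h G = ∫_M φ^*β ∧ Ψ_t^*(ι_{Y_h} dΞ)`, `Y_h = ∂_pΨ(·,x)(t)h`; as `dπ` is `ℂ`-linear and
`dπ(Y_h) = h`, `Y_{ih} − iY_h = dι(w)` is vertical, and `ι_{dι w} dΞ` pulled back to the fibre is
`ι_w d(ι^*Ξ) = 0`; finally `(ι_{Y} + i ι_{iY}) dΞ` vanishes on vertical vectors by the linearity
hypothesis, so `∂_{ih} G = i ∂_h G`.

## References

* C. Voisin, *Hodge Theory and Complex Algebraic Geometry I*, CUP (2002), §10.2.2, proof of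
  Thm. 10.9; §9.2.2. [VoisinHodgeI2002]
* P. Griffiths, Periods of integrals on algebraic manifolds II, Amer. J. Math. 90 (1968),
  Thm. 1.1. [Griffiths1968]
* P. Griffiths, On the periods of certain rational integrals I, Ann. of Math. 90 (1969), §8 (periods of
  residues vary holomorphically). [Griffiths1969]
-/

noncomputable section

open scoped Manifold ContDiff Topology
open Bundle Set Function Filter Module Complex
open Literature.Geometry.Kaehler Literature.NumberTheory.Transcendental
open Literature.AlgebraicGeometry.Motives Literature.Analysis.Complex

namespace Literature.AlgebraicGeometry.HodgeTheory

-- The identification `TangentSpace I x = E` is an abuse of definitional equality; as in the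
-- tree's form files we let `isDefEq` unfold it.
set_option backward.isDefEq.respectTransparency false

variable {EM : Type*} [NormedAddCommGroup EM] [NormedSpace ℂ EM] [FiniteDimensional ℂ EM]
  [MeasurableSpace EM] [BorelSpace EM] {N : ℕ} [Fact (finrank ℝ EM = N)]
  {M : Type*} [TopologicalSpace M] [ChartedSpace EM M] [IsManifold 𝓘(ℝ, EM) ∞ M]
  [T2Space M] [CompactSpace M]
  {o : (x : M) → Orientation ℝ (TangentSpace 𝓘(ℝ, EM) x) (Fin N)}
  {ET : Type*} [NormedAddCommGroup ET] [NormedSpace ℂ ET]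
  {T : Type*} [TopologicalSpace T] [ChartedSpace ET T] [IsManifold 𝓘(ℝ, ET) ∞ T]
  {EX : Type*} [NormedAddCommGroup EX] [NormedSpace ℂ EX]
  {X : Type*} [TopologicalSpace X] [ChartedSpace EX X] [IsManifold 𝓘(ℝ, EX) ∞ X]
  {P : Type*} [NormedAddCommGroup P] [NormedSpace ℂ P] [FiniteDimensional ℂ P]

/-- **Holomorphy of period-type integrals, vertical form** (Griffiths 1968 / 1969 §8; Voisin I, proof
of Thm. 10.9 — the variant for relative holomorphic forms; see the module docstring). Data: a compact
oriented `M` (continuous orientation family), a family `Ψ : P → M → T` jointly smooth on `U × M`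
(`U ∋ t` open) with `π ∘ Ψ p = p` on `U`, `dπ` differentiable and `ℂ`-linear along `Ψ t`; the fibre
presented as `Ψ t = ι ∘ φ` with `ι : X → T` smooth with `ℂ`-linear differential, `φ : M → X` smooth,
and verticality `ker dπ_{Ψ t x} ⊆ im dι_{φ x}`; a smooth `(k+1)`-form `Ξ` on `T` whose restriction
`ι^*Ξ` to the fibre is CLOSED and whose differential is, along the fibre, `ℂ`-linear in the first slot
on vertical arguments; ANY smooth closed `l`-form `β` on `X`, `dim M = l + (k + 1)`. Conclusion:
`p ↦ ∫_M φ^*β ∧ Ψ_p^*Ξ` is complex differentiable at `t`.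
[cite: VoisinHodgeI2002, §10.2.2 (proof of Thm. 10.9)] [cite: Griffiths1969, §8] -/
theorem differentiableAt_complex_cintegral_wedge_pullback_family_of_vertical (ho : IsContinuousOrientation o)
    {Ψ : P → M → T} {U : Set P} (hU : IsOpen U) {t : P} (ht : t ∈ U)
    (hΨ : ∀ p ∈ U, ∀ x, ContMDiffAt (𝓘(ℝ, P).prod 𝓘(ℝ, EM)) 𝓘(ℝ, ET) ∞ (uncurry Ψ) (p, x))
    {proj : T → P} (hπΨ : ∀ p ∈ U, ∀ x, proj (Ψ p x) = p)
    (hπd : ∀ x, MDifferentiableAt 𝓘(ℝ, ET) 𝓘(ℝ, P) proj (Ψ t x))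
    (hπℂ : ∀ x (v : ET), mfderiv 𝓘(ℝ, ET) 𝓘(ℝ, P) proj (Ψ t x) (I • v) =
      I • (show P from mfderiv 𝓘(ℝ, ET) 𝓘(ℝ, P) proj (Ψ t x) v))
    {ι : X → T} {φ : M → X} (hιφ : ι ∘ φ = Ψ t)
    (hι : ContMDiff 𝓘(ℝ, EX) 𝓘(ℝ, ET) ∞ ι) (hφ : ContMDiff 𝓘(ℝ, EM) 𝓘(ℝ, EX) ∞ φ)
    (hιℂ : ∀ y (v : EX), mfderiv 𝓘(ℝ, EX) 𝓘(ℝ, ET) ι y (I • v) =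
      I • (show ET from mfderiv 𝓘(ℝ, EX) 𝓘(ℝ, ET) ι y v))
    (hvert : ∀ x (w : ET), mfderiv 𝓘(ℝ, ET) 𝓘(ℝ, P) proj (Ψ t x) w = 0 →
      ∃ w' : EX, mfderiv 𝓘(ℝ, EX) 𝓘(ℝ, ET) ι (φ x) w' = w)
    {k l : ℕ} (hkl : l + (k + 1) = N)
    {Ξ : MForm 𝓘(ℝ, ET) T ℂ (k + 1)} (hΞ : IsSmoothForm Ξ)
    (hΞι : IsClosedForm (Ξ.pullback 𝓘(ℝ, EX) ι))
    (hdΞ : ∀ x (v : ET) (w : Fin (k + 1) → EX),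
      (show ET [⋀^Fin (k + 1 + 1)]→L[ℝ] ℂ from mextDeriv Ξ (Ψ t x))
          (Fin.cons (I • v) fun i ↦ (show ET from mfderiv 𝓘(ℝ, EX) 𝓘(ℝ, ET) ι (φ x) (w i))) =
        I * (show ET [⋀^Fin (k + 1 + 1)]→L[ℝ] ℂ from mextDeriv Ξ (Ψ t x))
          (Fin.cons v fun i ↦ (show ET from mfderiv 𝓘(ℝ, EX) 𝓘(ℝ, ET) ι (φ x) (w i))))
    {β : MForm 𝓘(ℝ, EX) X ℂ l} (hβ : IsSmoothForm β) (hβc : IsClosedForm β) :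
    DifferentiableAt ℂ (fun p ↦ cintegral o
      (((β.pullback 𝓘(ℝ, EM) φ).wedge (Ξ.pullback 𝓘(ℝ, EM) (Ψ p))).castDeg hkl)) t := by
  subst hkl
  haveI : WedgeFacts 𝓘(ℝ, EM) M ℂ := wedgeFacts_discharged _ _ ℂ
  -- the pulled-back form `γ = φ^*β` is smooth and closed
  set γ : MForm 𝓘(ℝ, EM) M ℂ l := β.pullback 𝓘(ℝ, EM) φ with hγdef
  have hγ : IsSmoothForm γ := isSmoothForm_pullback hφ hβ
  have hγc : IsClosedForm γ := by
    change mextDeriv γ = 0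
    rw [hγdef, mextDeriv_pullback hφ hβ, show mextDeriv β = 0 from hβc, MForm.pullback_zero]
  -- the real derivative
  obtain ⟨G', hG', hG'h⟩ := hasFDerivAt_cintegral_wedge_pullback_family (IT := 𝓘(ℝ, ET)) ho hU
    ht hΨ rfl hΞ hγ hγc
  refine differentiableAt_complex_of_hasFDerivAt_of_map_I_smul hG' fun h ↦ ?_
  -- notation: the contraction form `A v = Ψ_t^*(ι_{Y_v} dΞ)`
  set A : P → MForm 𝓘(ℝ, EM) M ℂ (k + 1) := fun v x ↦
    letI b : ET [⋀^Fin (k + 1 + 1)]→L[ℝ] ℂ := mextDeriv Ξ (Ψ t x);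
    (b.curryLeft (mfderiv 𝓘(ℝ, P) 𝓘(ℝ, ET) (fun p ↦ Ψ p x) t v)).compContinuousLinearMap
      (mfderiv 𝓘(ℝ, EM) 𝓘(ℝ, ET) (Ψ t) x) with hA
  have hG'A : ∀ v, G' v = cintegral o (γ.wedge (A v)) := fun v ↦ hG'h v
  -- smoothness of `A v` (for the linearity of `∫`)
  have hΨev : ∀ x, ∀ᶠ q in 𝓝 (t, x),
      ContMDiffAt (𝓘(ℝ, P).prod 𝓘(ℝ, EM)) 𝓘(ℝ, ET) ∞ (uncurry Ψ) q := by
    intro x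
    have h1 : ∀ᶠ q : P × M in 𝓝 (t, x), q.1 ∈ U :=
      continuousAt_fst.preimage_mem_nhds (hU.mem_nhds ht)
    exact h1.mono fun q hq ↦ hΨ q.1 hq q.2
  have hdΞs : IsSmoothForm (mextDeriv Ξ) := isSmoothForm_mextDeriv (inChart_mextDeriv_holds _ _ _) hΞ
  have hAs : ∀ v, IsSmoothForm (A v) := fun v x ↦
    smoothAt_contraction_family (I := 𝓘(ℝ, EM)) (I' := 𝓘(ℝ, ET)) hdΞs v (hΨev x)
  -- KEY: `γ ∧ A (i h) = i (γ ∧ A h)` pointwise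
  have hkey : γ.wedge (A (I • h)) = I • γ.wedge (A h) := by
    funext x
    -- the players at the point `x`
    obtain ⟨hmd, hmdP⟩ := mdifferentiableAt_slices_of_contMDiffAt (hΨev x).self_of_nhds
    set D : EM →L[ℝ] ET := mfderiv 𝓘(ℝ, EM) 𝓘(ℝ, ET) (Ψ t) x with hD
    set Y : P →L[ℝ] ET := mfderiv 𝓘(ℝ, P) 𝓘(ℝ, ET) (fun p ↦ Ψ p x) t with hY
    set Dι : EX →L[ℝ] ET := mfderiv 𝓘(ℝ, EX) 𝓘(ℝ, ET) ι (φ x) with hDι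
    set Dφ : EM →L[ℝ] EX := mfderiv 𝓘(ℝ, EM) 𝓘(ℝ, EX) φ x with hDφ
    set d : ET [⋀^Fin (k + 1 + 1)]→L[ℝ] ℂ := mextDeriv Ξ (Ψ t x) with hd
    have hιφx : ι (φ x) = Ψ t x := congr_fun hιφ x
    -- (1) `dπ ∘ Y = id`
    have hπY : ∀ v, mfderiv 𝓘(ℝ, ET) 𝓘(ℝ, P) proj (Ψ t x) (Y v) = v := by
      intro v
      have hev : (proj ∘ fun p ↦ Ψ p x) =ᶠ[𝓝 t] id :=
        Filter.eventually_of_mem (hU.mem_nhds ht) fun p hp ↦ hπΨ p hp x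
      have hcomp : mfderiv 𝓘(ℝ, P) 𝓘(ℝ, P) (proj ∘ fun p ↦ Ψ p x) t =
          (mfderiv 𝓘(ℝ, ET) 𝓘(ℝ, P) proj (Ψ t x)).comp Y := mfderiv_comp t (hπd x) hmdP
      have hid : mfderiv 𝓘(ℝ, P) 𝓘(ℝ, P) (proj ∘ fun p ↦ Ψ p x) t = ContinuousLinearMap.id ℝ P := by
        rw [hev.mfderiv_eq, mfderiv_id]
        rfl
      have h3 := ContinuousLinearMap.ext_iff.1 (hcomp.symm.trans hid) v
      exact h3
    -- (2) the vertical vector `W = Y (i h) - i Y h = dι w`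
    obtain ⟨w, hw⟩ : ∃ w : EX, Dι w = Y (I • h) - I • Y h := by
      have h0 : mfderiv 𝓘(ℝ, ET) 𝓘(ℝ, P) proj (Ψ t x) (Y (I • h) - I • Y h) = 0 := by
        rw [map_sub, hπℂ, hπY, hπY, sub_self]
      obtain ⟨w, hw⟩ := hvert x _ h0
      exact ⟨w, hw⟩
    -- (3) `dΨ_t = dι ∘ dφ`
    have hDcomp : D = Dι.comp Dφ := by
      rw [hD, ← hιφ]
      exact mfderiv_comp x (hι.mdifferentiableAt (by simp)) (hφ.mdifferentiableAt (by simp))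
    -- (4) `ι^* dΞ = 0` at `φ x`
    have hdι : d.compContinuousLinearMap Dι = 0 := by
      have h1 : mextDeriv (Ξ.pullback 𝓘(ℝ, EX) ι) = (mextDeriv Ξ).pullback 𝓘(ℝ, EX) ι :=
        mextDeriv_pullback hι hΞ
      rw [show mextDeriv (Ξ.pullback 𝓘(ℝ, EX) ι) = 0 from hΞι] at h1
      have h2 := congr_fun h1 (φ x)
      rw [hd, hDι, ← hιφx]
      exact h2.symm
    -- `dι` is `ℂ`-linear
    have hDιℂ : ∀ (c : ℂ) (v : EX), Dι (c • v) = c • Dι v := fun c v ↦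
      map_complex_smul_of_map_I_smul (Dι : EX →ₗ[ℝ] ET) (fun v ↦ hιℂ (φ x) v) c v
    -- (5) algebra of the contraction: `A (i h) x = (ι_{i Y h} dΞ) ∘ dΨ_t`
    have hAI : (A (I • h)) x = (d.curryLeft (I • Y h)).compContinuousLinearMap D := by
      change (d.curryLeft (Y (I • h))).compContinuousLinearMap D = _
      have hsplit : Y (I • h) = I • Y h + Dι w := by rw [hw]; abel
      rw [hsplit, map_add, Literature.Analysis.Calculus.add_compContinuousLinearMap', hDcomp,
        ← Literature.Analysis.Calculus.compContinuousLinearMap_compContinuousLinearMap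
          (d.curryLeft (Dι w)),
        ← ContinuousAlternatingMap.curryLeft_compContinuousLinearMap, hdι]
      simp [zero_compContinuousLinearMap']
    have hAh : (A h) x = (d.curryLeft (Y h)).compContinuousLinearMap D := rfl
    -- (6) the antilinear contraction vanishes on vertical vectors (`dΞ` is `ℂ`-linear in the
    -- transverse slot along the fibre)
    set B : ET [⋀^Fin (k + 1)]→L[ℝ] ℂ := d.curryLeft (Y h) + I • d.curryLeft (I • Y h) with hB
    have hvanishB : B.compContinuousLinearMap Dι = 0 := by
      ext w
      rw [ContinuousAlternatingMap.compContinuousLinearMap_apply, hB,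
        ContinuousAlternatingMap.add_apply, ContinuousAlternatingMap.smul_apply,
        ContinuousAlternatingMap.curryLeft_apply_apply, ContinuousAlternatingMap.curryLeft_apply_apply,
        ContinuousAlternatingMap.coe_zero, Pi.zero_apply]
      have hlin := hdΞ x (Y h) w
      change d (Fin.cons (I • Y h) fun i ↦ Dι (w i)) = I * d (Fin.cons (Y h) fun i ↦ Dι (w i)) at hlin
      change d (Fin.cons (Y h) fun i ↦ Dι (w i)) + I • d (Fin.cons (I • Y h) fun i ↦ Dι (w i)) = 0
      rw [hlin, smul_eq_mul, ← mul_assoc, Complex.I_mul_I]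
      ring
    -- (7) conclusion at `x`
    set γx : EM [⋀^Fin l]→L[ℝ] ℂ := γ x with hγx
    have hsplit : d.curryLeft (I • Y h) = I • d.curryLeft (Y h) + (-I) • B := by
      rw [hB, smul_add, smul_smul, neg_mul, Complex.I_mul_I, neg_neg, one_smul, neg_smul]
      abel
    have hzero : γx.wedge (B.compContinuousLinearMap D) = 0 := by
      rw [hDcomp, ← Literature.Analysis.Calculus.compContinuousLinearMap_compContinuousLinearMap,
        hvanishB, zero_compContinuousLinearMap', ContinuousAlternatingMap.wedge_zero]
    change γx.wedge ((A (I • h)) x) = I • γx.wedge ((A h) x)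
    rw [hAI, hAh, hsplit, Literature.Analysis.Calculus.add_compContinuousLinearMap',
      complex_smul_compContinuousLinearMap, complex_smul_compContinuousLinearMap,
      ContinuousAlternatingMap.wedge_add_right, wedge_smul_right_complex,
      wedge_smul_right_complex, hzero]
    have h0 : (-I) • (0 : EM [⋀^Fin (l + (k + 1))]→L[ℝ] ℂ) = 0 :=
      @smul_zero ℂ (EM [⋀^Fin (l + (k + 1))]→L[ℝ] ℂ) _ _ (-I)
    exact (congrArg (fun z ↦ I • γx.wedge ((d.curryLeft (Y h)).compContinuousLinearMap D) + z)
      h0).trans (add_zero _)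
  -- integrate
  rw [hG'A, hG'A, hkey, HodgeRiemannDegreeOne.cintegral_smul' o ho I (isSmoothForm_wedge hγ (hAs h))]


end Literature.AlgebraicGeometry.HodgeTheory

end
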